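import Mathlib
import Summits.CriticalPhenomena.PercolationContinuityZ3.Theorems.PercNonProliferationFreeBoxPowerSavingSizeSplitting
import Summits.CriticalPhenomena.PercolationContinuityZ3.Theorems.PercNonProliferationFreeBoxPowerSavingLogBoost
import Summits.CriticalPhenomena.PercolationContinuityZ3.Theorems.FreeBoxPowerSaving.Negative.FreeBoxPowerSavingStubGuards

/-!
# Crux `PercNonProliferation.FreeBoxPowerSaving` (stmt-CriticalPhenomena-4447), line
# `boundary-interior-split-fat-finite-clusters` — the shattering boost for the open one-bit stubs

Helper file of the lead (prover-line-stmt-CriticalPhenomena-4447-1, gen 1) for the checked skeleton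
`Cruxes/FreeBoxPowerSaving/Lines/boundary_interior_split_fat_finite_clusters.lean`; lands with
`--supports stmt-CriticalPhenomena-4447`.  It does not close a registered stub: it RESHAPES the open
one-bit residual shared by both lines of this crux (the hypothesis of the landed `stub_logBoost`,
"quasi-giants are not asymptotically almost sure", QG-NAS, and through it the boundary stub
`stub_boundaryQuasiGiantsNotAS`) into a strictly weaker-looking target, kernel-checked.

Bond percolation `P_p` on `ℤ³`, free box `B(n) = box 3 n`, `q_p(n, t) = P_p(QG(n, t))` where
`QG(n, t)` = "some vertex of `B(n)` is joined inside `B(n)` to at least `t` vertices of `B(n)`".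

* `Boost.one_sub_le_log_div_two_pow` (THE BOOST, every `p`): for real `s ≥ 1` and every `k`,
  if `q_p(n, 3^k s) > 0` then `1 - q_p(n, s) ≤ log(1 / q_p(n, 3^k s)) / 2^k`.  Proof: the landed
  size splitting `q(3s) ≤ q(s)²` (`FreeBoxPowerSavingLine.stub_sizeSplitting`, p77722) iterates to
  `q(3^k s) ≤ q(s)^{2^k}` (`LogBoost.iterate_sq`, p79965), and `1 - x ≤ -log x = -log(x^{2^k})/2^k
  ≤ log(1/q(3^k s))/2^k`.  Read downwards in the threshold: IF fat pieces at some threshold are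
  present with probability bounded away from `0`, then at every polynomially smaller threshold they
  are present with probability POLYNOMIALLY close to `1` (rate `n^{-0.63·gap}`, `0.63 = log 2/log 3`).
* `Boost.quasiGiantNotAS_of_polyRareShattering` (every `p`): if for some `a, b` with `0 < b` and
  `b·log 3 < a·log 2` eventually `P_p(no piece of B(n) has ≥ n^{3-a} vertices) ≥ n^{-b}`
  ("shattering is at worst polynomially rare"), then for `a' = (a - b log 3/log 2)/2 > 0` eventually
  `q_p(n, n^{3-a'}) ≤ 1/2` — which is VERBATIM the one-bit hypothesis of `stub_logBoost`
  (`∃ a' ε > 0, ∀ᶠ n, q ≤ 1 - ε`).  The converse is trivial (`ε ≥ n^{-b}` eventually), so modulo the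
  landed stubs the crux is EQUIVALENT to polynomially-rare shattering at `p_c`: any inverse-polynomial
  LOWER bound `n^{-b}`, `b < 0.63 a`, on the probability that the critical free box has no piece of
  `n^{3-a}` vertices proves `FreeBoxPowerSaving` (`freeBoxPowerSaving_of_polyRareShattering`), whereas
  the orthodox prediction is that this probability tends to ONE for every `a < 3 - d_f ≈ 0.48`.
* `Boost.boundaryQuasiGiantsNotAS_of_quasiGiantNotAS`: the boundary one-bit stub of this line is
  implied by QG-NAS with the same `(a, ε)` (inclusion of events), hence also by polynomially-rare
  shattering (`boundaryQuasiGiantsNotAS_of_polyRareShattering`).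

Degenerate parameters: `a ≤ 0` or `a ≥ 3` make the shattering hypothesis fail eventually (for
`a ≥ 3` the event `QG(n, n^{3-a})` is sure, `FreeBoxPowerSavingNegative.exists_piece_ge_eq_univ_of_le_one`),
so nothing is claimed there; `p ∈ {0, 1}`: at `p = 1` the hypothesis fails (one piece), at `p = 0`
it holds and so does the conclusion.
-/

noncomputable section

open MeasureTheory Filter Topology
open scoped Classical
open Literature.Probability.Percolation Literature.Probability.LatticeModels

namespace Summit.CriticalPhenomena.PercolationContinuityZ3.FreeBoxPowerSavingLine

namespace Boost

/-- `q` is antitone in the threshold. -/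
theorem q_anti (p : unitInterval) (n : ℕ) {s t : ℝ} (hst : s ≤ t) : ((bondPercolation (zdGraph 3) p).real
        {ω | ∃ u ∈ box 3 n, (t : ℝ) ≤
          (((box 3 n).filter fun v => ω ∈ openConnIn ↑(box 3 n) u v).card : ℝ)}) ≤ ((bondPercolation (zdGraph 3) p).real
        {ω | ∃ u ∈ box 3 n, (s : ℝ) ≤
          (((box 3 n).filter fun v => ω ∈ openConnIn ↑(box 3 n) u v).card : ℝ)}) := by
  refine measureReal_mono ?_ (measure_ne_top _ _)
  rintro ω ⟨u, hu, h⟩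
  exact ⟨u, hu, hst.trans h⟩

/-- `q ≤ 1`. -/
theorem q_le_one (p : unitInterval) (n : ℕ) (t : ℝ) : ((bondPercolation (zdGraph 3) p).real
        {ω | ∃ u ∈ box 3 n, (t : ℝ) ≤
          (((box 3 n).filter fun v => ω ∈ openConnIn ↑(box 3 n) u v).card : ℝ)}) ≤ 1 := measureReal_le_one

/-- `q ≥ 0`. -/
theorem q_nonneg (p : unitInterval) (n : ℕ) (t : ℝ) : 0 ≤ ((bondPercolation (zdGraph 3) p).real
        {ω | ∃ u ∈ box 3 n, (t : ℝ) ≤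
          (((box 3 n).filter fun v => ω ∈ openConnIn ↑(box 3 n) u v).card : ℝ)}) := measureReal_nonneg

/-- `q(t) = 1` for `t ≤ 1` (every vertex is its own piece). -/
theorem q_eq_one_of_le_one (p : unitInterval) (n : ℕ) {t : ℝ} (ht : t ≤ 1) : ((bondPercolation (zdGraph 3) p).real
        {ω | ∃ u ∈ box 3 n, (t : ℝ) ≤
          (((box 3 n).filter fun v => ω ∈ openConnIn ↑(box 3 n) u v).card : ℝ)}) = 1 := by
  rw [FreeBoxPowerSavingNegative.exists_piece_ge_eq_univ_of_le_one n ht, probReal_univ]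

/-- **Iterated size splitting**: `q(3^k s) ≤ q(s)^{2^k}` for real `s ≥ 1` (landed
`stub_sizeSplitting`, p77722, iterated by `LogBoost.iterate_sq`, p79965). -/
theorem q_three_pow_mul_le (p : unitInterval) (n : ℕ) {s : ℝ} (hs : 1 ≤ s) (k : ℕ) :
    ((bondPercolation (zdGraph 3) p).real
            {ω | ∃ u ∈ box 3 n, ((3 : ℝ) ^ k * s : ℝ) ≤
              (((box 3 n).filter fun v => ω ∈ openConnIn ↑(box 3 n) u v).card : ℝ)}) ≤ ((bondPercolation (zdGraph 3) p).real
            {ω | ∃ u ∈ box 3 n, (s : ℝ) ≤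
              (((box 3 n).filter fun v => ω ∈ openConnIn ↑(box 3 n) u v).card : ℝ)}) ^ (2 ^ k) :=
  LogBoost.iterate_sq (fun t => ((bondPercolation (zdGraph 3) p).real
          {ω | ∃ u ∈ box 3 n, (t : ℝ) ≤
            (((box 3 n).filter fun v => ω ∈ openConnIn ↑(box 3 n) u v).card : ℝ)})) (fun _ => measureReal_nonneg)
    (fun t ht => stub_sizeSplitting p n t ht) hs k

/-- **The shattering boost** (every `p`): for real `s ≥ 1` and every `k`, if fat pieces at the
threshold `3^k s` have positive probability then
`1 - q(s) ≤ log(1 / q(3^k s)) / 2^k`. -/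
theorem one_sub_le_log_div_two_pow (p : unitInterval) (n : ℕ) {s : ℝ} (hs : 1 ≤ s) (k : ℕ)
    (hpos : 0 < ((bondPercolation (zdGraph 3) p).real
            {ω | ∃ u ∈ box 3 n, ((3 : ℝ) ^ k * s : ℝ) ≤
              (((box 3 n).filter fun v => ω ∈ openConnIn ↑(box 3 n) u v).card : ℝ)})) :
    1 - ((bondPercolation (zdGraph 3) p).real
            {ω | ∃ u ∈ box 3 n, (s : ℝ) ≤
              (((box 3 n).filter fun v => ω ∈ openConnIn ↑(box 3 n) u v).card : ℝ)}) ≤ Real.log (((bondPercolation (zdGraph 3) p).real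
            {ω | ∃ u ∈ box 3 n, ((3 : ℝ) ^ k * s : ℝ) ≤
              (((box 3 n).filter fun v => ω ∈ openConnIn ↑(box 3 n) u v).card : ℝ)}))⁻¹ / 2 ^ k := by
  have hiter := q_three_pow_mul_le p n hs k
  set x : ℝ := ((bondPercolation (zdGraph 3) p).real
          {ω | ∃ u ∈ box 3 n, (s : ℝ) ≤
            (((box 3 n).filter fun v => ω ∈ openConnIn ↑(box 3 n) u v).card : ℝ)}) with hx
  set y : ℝ := ((bondPercolation (zdGraph 3) p).real
          {ω | ∃ u ∈ box 3 n, ((3 : ℝ) ^ k * s : ℝ) ≤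
            (((box 3 n).filter fun v => ω ∈ openConnIn ↑(box 3 n) u v).card : ℝ)}) with hy
  have hx1 : x ≤ 1 := q_le_one p n s
  have hxpos : 0 < x := by
    by_contra hle
    have hx0 : x = 0 := le_antisymm (not_lt.1 hle) (q_nonneg p n s)
    have hx0' : x ^ (2 ^ k) = 0 := by rw [hx0]; exact zero_pow (pow_ne_zero k two_ne_zero)
    have : y ≤ 0 := hiter.trans_eq hx0'
    exact absurd hpos (not_lt.2 this)
  have h2k : (0 : ℝ) < 2 ^ k := by positivity
  -- `log y ≤ 2^k log x`
  have hlog : Real.log y ≤ (2 ^ k : ℝ) * Real.log x := by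
    calc Real.log y ≤ Real.log (x ^ (2 ^ k)) := Real.log_le_log hpos hiter
      _ = (2 ^ k : ℕ) * Real.log x := Real.log_pow _ _
      _ = (2 ^ k : ℝ) * Real.log x := by push_cast; ring
  -- `1 - x ≤ -log x`
  have h1x : 1 - x ≤ -Real.log x := by
    have := Real.log_le_sub_one_of_pos hxpos
    linarith
  rw [Real.log_inv, le_div_iff₀ h2k]
  calc (1 - x) * 2 ^ k ≤ -Real.log x * 2 ^ k := by gcongr
    _ = -((2 ^ k : ℝ) * Real.log x) := by ring
    _ ≤ -Real.log y := by linarith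

/-- Scale bookkeeping: for `g > 0` and `n ≥ 1`, with `k = ⌊g log n / log 3⌋₊` one has
`3^k ≤ n^g` and `n^{g log 2/log 3} ≤ 2 · 2^k`. -/
theorem scales {g : ℝ} (hg : 0 < g) {n : ℕ} (hn : 1 ≤ n) :
    (3 : ℝ) ^ ⌊g * Real.log n / Real.log 3⌋₊ ≤ (n : ℝ) ^ g ∧
      (n : ℝ) ^ (g * (Real.log 2 / Real.log 3)) ≤ 2 * 2 ^ ⌊g * Real.log n / Real.log 3⌋₊ := by
  set L : ℝ := g * Real.log n / Real.log 3 with hL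
  set k : ℕ := ⌊L⌋₊ with hk
  have hn0 : (0 : ℝ) < n := by exact_mod_cast hn
  have hlog3 : 0 < Real.log 3 := Real.log_pos (by norm_num)
  have hlog2 : 0 < Real.log 2 := Real.log_pos (by norm_num)
  have hlogn : 0 ≤ Real.log n := Real.log_nonneg (by exact_mod_cast hn)
  have hL0 : 0 ≤ L := by rw [hL]; positivity
  have hkL : (k : ℝ) ≤ L := Nat.floor_le hL0
  have hLk : L < k + 1 := Nat.lt_floor_add_one L
  constructor
  · -- `3^k = exp(k log 3) ≤ exp(g log n) = n^g`
    have h3 : (3 : ℝ) ^ k = Real.exp (k * Real.log 3) := by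
      rw [← Real.rpow_natCast, Real.rpow_def_of_pos (by norm_num : (0 : ℝ) < 3)]; ring_nf
    rw [h3, Real.rpow_def_of_pos hn0]
    apply Real.exp_le_exp.2
    have : (k : ℝ) * Real.log 3 ≤ L * Real.log 3 := by gcongr
    calc (k : ℝ) * Real.log 3 ≤ L * Real.log 3 := this
      _ = g * Real.log n := by rw [hL]; field_simp
      _ = Real.log n * g := by ring
  · -- `n^{g log2/log3} = exp(L log 2) ≤ exp((k+1) log 2) = 2 · 2^k`
    have h2 : (2 : ℝ) * 2 ^ k = Real.exp ((k + 1) * Real.log 2) := by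
      rw [show (2 : ℝ) * 2 ^ k = 2 ^ (k + 1) by ring, ← Real.rpow_natCast,
        Real.rpow_def_of_pos (by norm_num : (0 : ℝ) < 2)]
      push_cast; ring_nf
    rw [h2, Real.rpow_def_of_pos hn0]
    apply Real.exp_le_exp.2
    calc Real.log n * (g * (Real.log 2 / Real.log 3)) = L * Real.log 2 := by rw [hL]; field_simp
      _ ≤ (k + 1) * Real.log 2 := by gcongr

/-- **Polynomially-rare shattering suffices** (every `p`).  If for some `a, b` with `0 < b` and
`b log 3 < a log 2` eventually `n^{-b} ≤ 1 - q_p(n, n^{3-a})` (with probability at least `n^{-b}`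
NO free-box piece has `≥ n^{3-a}` vertices), then with `a' = (a - b log 3/log 2)/2 > 0` eventually
`q_p(n, n^{3-a'}) ≤ 1/2`: quasi-giants at exponent `a'` are not asymptotically almost sure — VERBATIM
the one-bit hypothesis of the landed `stub_logBoost`.  Proof: otherwise `q(n^{3-a'}) > 1/2`, so
`q(3^k n^{3-a}) > 1/2` for `3^k ≤ n^{a-a'}` (antitonicity), and the boost gives
`1 - q(n^{3-a}) ≤ log 2 / 2^k ≤ 2 log 2 · n^{-(a-a') log 2/log 3} < n^{-b}` eventually, since
`(a - a') log 2/log 3 > b`. -/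
theorem quasiGiantNotAS_of_polyRareShattering_at (p : unitInterval) {a b : ℝ} (hb : 0 < b)
    (hab : b * Real.log 3 < a * Real.log 2)
    (h : ∀ᶠ n : ℕ in atTop, (n : ℝ) ^ (-b) ≤ 1 - ((bondPercolation (zdGraph 3) p).real
            {ω | ∃ u ∈ box 3 n, ((n : ℝ) ^ (3 - a) : ℝ) ≤
              (((box 3 n).filter fun v => ω ∈ openConnIn ↑(box 3 n) u v).card : ℝ)})) :
    ∃ a' ε : ℝ, 0 < a' ∧ 0 < ε ∧ ∀ᶠ n : ℕ in atTop, ((bondPercolation (zdGraph 3) p).real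
            {ω | ∃ u ∈ box 3 n, ((n : ℝ) ^ (3 - a') : ℝ) ≤
              (((box 3 n).filter fun v => ω ∈ openConnIn ↑(box 3 n) u v).card : ℝ)}) ≤ 1 - ε := by
  have hlog3 : 0 < Real.log 3 := Real.log_pos (by norm_num)
  have hlog2 : 0 < Real.log 2 := Real.log_pos (by norm_num)
  -- the exponent gap `g = a - a'` and its boosted rate `c = g log 2/log 3 > b`
  set r : ℝ := Real.log 2 / Real.log 3 with hr
  have hr0 : 0 < r := div_pos hlog2 hlog3
  have hbr : b / r < a := by
    rw [hr, div_div_eq_mul_div, div_lt_iff₀ hlog2]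
    linarith
  have hbr0 : 0 < b / r := div_pos hb hr0
  set a' : ℝ := (a - b / r) / 2 with ha'
  have ha'0 : 0 < a' := by rw [ha']; linarith
  set g : ℝ := a - a' with hg
  have hg0 : 0 < g := by rw [hg, ha']; linarith
  set c : ℝ := g * r with hc
  have hcb : b < c := by
    have : g = (a + b / r) / 2 := by rw [hg, ha']; ring
    rw [hc, this]
    have hbr' : b = b / r * r := by field_simp
    nlinarith [hbr, hr0]
  refine ⟨a', 1 / 2, ha'0, by norm_num, ?_⟩
  -- eventually `2 log 2 · n^{-c} < n^{-b}`
  have hsmall : ∀ᶠ n : ℕ in atTop, 2 * Real.log 2 * (n : ℝ) ^ (-c) < (n : ℝ) ^ (-b) := by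
    have hlim : Tendsto (fun n : ℕ => 2 * Real.log 2 * (n : ℝ) ^ (-(c - b))) atTop (𝓝 0) := by
      have h := ((tendsto_rpow_neg_atTop (by linarith : 0 < c - b)).comp
        tendsto_natCast_atTop_atTop).const_mul (2 * Real.log 2)
      simpa using h
    filter_upwards [hlim.eventually (gt_mem_nhds (by norm_num : (0 : ℝ) < 1)),
      eventually_ge_atTop 1] with n hn hn1
    have hn0 : (0 : ℝ) < n := by exact_mod_cast hn1
    have hsplit : (n : ℝ) ^ (-c) = (n : ℝ) ^ (-(c - b)) * (n : ℝ) ^ (-b) := by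
      rw [← Real.rpow_add hn0]; congr 1; ring
    rw [hsplit, ← mul_assoc]
    have hbpos : (0 : ℝ) < (n : ℝ) ^ (-b) := Real.rpow_pos_of_pos hn0 _
    calc 2 * Real.log 2 * (n : ℝ) ^ (-(c - b)) * (n : ℝ) ^ (-b)
        < 1 * (n : ℝ) ^ (-b) := mul_lt_mul_of_pos_right hn hbpos
      _ = (n : ℝ) ^ (-b) := one_mul _
  filter_upwards [h, hsmall, eventually_ge_atTop 1] with n hn hsm hn1
  have hn0 : (0 : ℝ) < n := by exact_mod_cast hn1
  have hn1' : (1 : ℝ) ≤ n := by exact_mod_cast hn1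
  -- the threshold `s = n^{3-a}` is `≥ 1` (else `q = 1` and `hn` fails)
  set s : ℝ := (n : ℝ) ^ (3 - a) with hs
  have hs1 : 1 ≤ s := by
    by_contra hlt
    push Not at hlt
    have hq1 : ((bondPercolation (zdGraph 3) p).real
            {ω | ∃ u ∈ box 3 n, (s : ℝ) ≤
              (((box 3 n).filter fun v => ω ∈ openConnIn ↑(box 3 n) u v).card : ℝ)}) = 1 := q_eq_one_of_le_one p n hlt.le
    have : (0 : ℝ) < (n : ℝ) ^ (-b) := Real.rpow_pos_of_pos hn0 _
    rw [hq1] at hn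
    linarith
  by_contra hcon
  push Not at hcon
  -- `q(n^{3-a'}) > 1/2`
  have hbig : 1 / 2 < ((bondPercolation (zdGraph 3) p).real
          {ω | ∃ u ∈ box 3 n, ((n : ℝ) ^ (3 - a') : ℝ) ≤
            (((box 3 n).filter fun v => ω ∈ openConnIn ↑(box 3 n) u v).card : ℝ)}) := by linarith
  -- scales
  obtain ⟨h3k, h2k⟩ := scales hg0 hn1
  set k : ℕ := ⌊g * Real.log n / Real.log 3⌋₊ with hk
  -- `3^k s ≤ n^{3-a'}`
  have hthr : (3 : ℝ) ^ k * s ≤ (n : ℝ) ^ (3 - a') := by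
    calc (3 : ℝ) ^ k * s ≤ (n : ℝ) ^ g * s := by gcongr
      _ = (n : ℝ) ^ (g + (3 - a)) := by rw [hs, ← Real.rpow_add hn0]
      _ = (n : ℝ) ^ (3 - a') := by congr 1; rw [hg]; ring
  have hpos : 1 / 2 < ((bondPercolation (zdGraph 3) p).real
          {ω | ∃ u ∈ box 3 n, ((3 : ℝ) ^ k * s : ℝ) ≤
            (((box 3 n).filter fun v => ω ∈ openConnIn ↑(box 3 n) u v).card : ℝ)}) := hbig.trans_le (q_anti p n hthr)
  have hpos0 : 0 < ((bondPercolation (zdGraph 3) p).real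
          {ω | ∃ u ∈ box 3 n, ((3 : ℝ) ^ k * s : ℝ) ≤
            (((box 3 n).filter fun v => ω ∈ openConnIn ↑(box 3 n) u v).card : ℝ)}) := by linarith
  -- the boost
  have hboost := one_sub_le_log_div_two_pow p n hs1 k hpos0
  -- `log(1/q) ≤ log 2`
  have hlogq : Real.log (((bondPercolation (zdGraph 3) p).real
          {ω | ∃ u ∈ box 3 n, ((3 : ℝ) ^ k * s : ℝ) ≤
            (((box 3 n).filter fun v => ω ∈ openConnIn ↑(box 3 n) u v).card : ℝ)}))⁻¹ ≤ Real.log 2 := by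
    apply Real.log_le_log (inv_pos.2 hpos0)
    rw [inv_le_comm₀ hpos0 (by norm_num)]
    linarith
  have h2kpos : (0 : ℝ) < 2 ^ k := by positivity
  -- `n^{-c} · (2 · 2^k) ≥ 1`
  have h2k' : (n : ℝ) ^ c ≤ 2 * 2 ^ k := h2k
  have hc_eq : (n : ℝ) ^ c * (n : ℝ) ^ (-c) = 1 := by
    rw [← Real.rpow_add hn0, add_neg_cancel, Real.rpow_zero]
  have hchain : 1 - ((bondPercolation (zdGraph 3) p).real
          {ω | ∃ u ∈ box 3 n, (s : ℝ) ≤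
            (((box 3 n).filter fun v => ω ∈ openConnIn ↑(box 3 n) u v).card : ℝ)}) ≤ 2 * Real.log 2 * (n : ℝ) ^ (-c) := by
    calc 1 - ((bondPercolation (zdGraph 3) p).real
            {ω | ∃ u ∈ box 3 n, (s : ℝ) ≤
              (((box 3 n).filter fun v => ω ∈ openConnIn ↑(box 3 n) u v).card : ℝ)}) ≤ Real.log (((bondPercolation (zdGraph 3) p).real
            {ω | ∃ u ∈ box 3 n, ((3 : ℝ) ^ k * s : ℝ) ≤
              (((box 3 n).filter fun v => ω ∈ openConnIn ↑(box 3 n) u v).card : ℝ)}))⁻¹ / 2 ^ k := hboost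
      _ ≤ Real.log 2 / 2 ^ k := by gcongr
      _ = Real.log 2 / 2 ^ k * ((n : ℝ) ^ c * (n : ℝ) ^ (-c)) := by rw [hc_eq, mul_one]
      _ ≤ Real.log 2 / 2 ^ k * ((2 * 2 ^ k) * (n : ℝ) ^ (-c)) := by
          apply mul_le_mul_of_nonneg_left _ (by positivity)
          exact mul_le_mul_of_nonneg_right h2k' (Real.rpow_nonneg hn0.le _)
      _ = 2 * Real.log 2 * (n : ℝ) ^ (-c) := by field_simp
  linarith

/-- **Polynomially-rare shattering suffices — registered form** (sub-goal of
stmt-CriticalPhenomena-4447, all binders explicit; every `p`): if for some `a, b` with `0 < b`,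
`b log 3 < a log 2` eventually `n^{-b} ≤ P_p(no piece of B(n) has ≥ n^{3-a} vertices)`, then for some
`a', ε > 0` eventually `P_p(some piece of B(n) has ≥ n^{3-a'} vertices) ≤ 1 - ε` (the one-bit
hypothesis of `stub_logBoost`, verbatim). -/
theorem quasiGiantNotAS_of_polyRareShattering :
    ∀ (p : unitInterval) (a b : ℝ), 0 < b → b * Real.log 3 < a * Real.log 2 →
      (∀ᶠ n : ℕ in atTop, (n : ℝ) ^ (-b) ≤ 1 - (bondPercolation (zdGraph 3) p).real
          {ω | ∃ u ∈ box 3 n, ((n : ℝ) ^ (3 - a) : ℝ) ≤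
            (((box 3 n).filter fun v => ω ∈ openConnIn ↑(box 3 n) u v).card : ℝ)}) →
      ∃ a' ε : ℝ, 0 < a' ∧ 0 < ε ∧ ∀ᶠ n : ℕ in atTop,
        (bondPercolation (zdGraph 3) p).real
            {ω | ∃ u ∈ box 3 n, ((n : ℝ) ^ (3 - a') : ℝ) ≤
              (((box 3 n).filter fun v => ω ∈ openConnIn ↑(box 3 n) u v).card : ℝ)} ≤ 1 - ε :=
  fun p _ _ hb hab h => quasiGiantNotAS_of_polyRareShattering_at p hb hab h

/-- **Polynomially-rare shattering at `p_c` proves the crux.**  Compose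
`quasiGiantNotAS_of_polyRareShattering` with the landed `stub_logBoost` (p79965; its size-splitting
hypothesis is the landed `stub_sizeSplitting`, p77722) and the landed normal form
`FreeBoxPowerSavingNegative.of_eventually` (p73056). -/
theorem freeBoxPowerSaving_of_polyRareShattering {a b : ℝ} (hb : 0 < b)
    (hab : b * Real.log 3 < a * Real.log 2)
    (h : ∀ᶠ n : ℕ in atTop, (n : ℝ) ^ (-b) ≤ 1 - ((bondPercolation (zdGraph 3) (criticalProbI 3)).real
            {ω | ∃ u ∈ box 3 n, ((n : ℝ) ^ (3 - a) : ℝ) ≤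
              (((box 3 n).filter fun v => ω ∈ openConnIn ↑(box 3 n) u v).card : ℝ)})) :
    Summit.CriticalPhenomena.PercolationContinuityZ3.Theses.PercNonProliferation.FreeBoxPowerSaving := by
  obtain ⟨a', ε, ha', hε, hev⟩ := quasiGiantNotAS_of_polyRareShattering_at (criticalProbI 3) hb hab h
  obtain ⟨a'', C, ha'', hev'⟩ :=
    stub_logBoost (criticalProbI 3) (stub_sizeSplitting (criticalProbI 3)) a' ε ha' hε hev
  obtain ⟨C', hC'⟩ := FreeBoxPowerSavingNegative.of_eventually ha'' hev'
  exact ⟨a'', C', ha'', fun n hn => hC' n hn⟩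

/-- **QG-NAS ⟹ the boundary one-bit stub, same `(a, ε)`**: a boundary-touching fat piece is a fat
piece.  (So `stub_boundaryQuasiGiantsNotAS` of the line is formally weaker than the sibling line's
residual `stub_quasiGiantNotAS`.) -/
theorem boundaryQuasiGiantsNotAS_of_quasiGiantNotAS (p : unitInterval) {a ε : ℝ}
    (h : ∀ᶠ n : ℕ in atTop, ((bondPercolation (zdGraph 3) p).real
            {ω | ∃ u ∈ box 3 n, ((n : ℝ) ^ (3 - a) : ℝ) ≤
              (((box 3 n).filter fun v => ω ∈ openConnIn ↑(box 3 n) u v).card : ℝ)}) ≤ 1 - ε) :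
    ∀ᶠ n : ℕ in atTop,
      (bondPercolation (zdGraph 3) p).real
          {ω | ∃ u ∈ innerBoundary (zdGraph 3) (box 3 n),
            (n : ℝ) ^ (3 - a) ≤
              (((box 3 n).filter fun v => ω ∈ openConnIn ↑(box 3 n) u v).card : ℝ)}
        ≤ 1 - ε := by
  filter_upwards [h] with n hn
  refine le_trans (measureReal_mono ?_ (measure_ne_top _ _)) hn
  rintro ω ⟨u, hu, h1⟩
  exact ⟨u, (mem_innerBoundary_iff.1 hu).1, h1⟩

/-- **Polynomially-rare shattering at `p` ⟹ `stub_boundaryQuasiGiantsNotAS` at `p`** (at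
`p = p_c` the conclusion is the registered stub verbatim). -/
theorem boundaryQuasiGiantsNotAS_of_polyRareShattering (p : unitInterval) {a b : ℝ} (hb : 0 < b)
    (hab : b * Real.log 3 < a * Real.log 2)
    (h : ∀ᶠ n : ℕ in atTop, (n : ℝ) ^ (-b) ≤ 1 - ((bondPercolation (zdGraph 3) p).real
            {ω | ∃ u ∈ box 3 n, ((n : ℝ) ^ (3 - a) : ℝ) ≤
              (((box 3 n).filter fun v => ω ∈ openConnIn ↑(box 3 n) u v).card : ℝ)})) :
    ∃ a' ε : ℝ, 0 < a' ∧ 0 < ε ∧ ∀ᶠ n : ℕ in atTop,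
      (bondPercolation (zdGraph 3) p).real
          {ω | ∃ u ∈ innerBoundary (zdGraph 3) (box 3 n),
            (n : ℝ) ^ (3 - a') ≤
              (((box 3 n).filter fun v => ω ∈ openConnIn ↑(box 3 n) u v).card : ℝ)}
        ≤ 1 - ε := by
  obtain ⟨a', ε, ha', hε, hev⟩ := quasiGiantNotAS_of_polyRareShattering_at p hb hab h
  exact ⟨a', ε, ha', hε, boundaryQuasiGiantsNotAS_of_quasiGiantNotAS p hev⟩

end Boost

end Summit.CriticalPhenomena.PercolationContinuityZ3.FreeBoxPowerSavingLine

end
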